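import Summits.Ventures.AbcSig.Rows.Statements
import Summits.Ventures.AbcSig.Rows.XnYn43Z2EvenX

/-!
# Venture AbcSig — CELL bridge for `xⁿ + yⁿ = 43 z²`, `xy` even: p1's census predicate `Rows.C1CellEven 43 11 ∅`

HONEST FRAMING. COMPUTATION cell `pub-abcsig`; CONDITIONAL theorem; no claim on ABC or any summit. Hypotheses exactly
those of `Rows/XnYn43Z2EvenX.lean` (`xrow_XnYn43Z2Even`): `BS04Package` (CITED), `EisChiPackage` (CITED), `DataComplete` /
`Refines` (COMPUTED, certified level files), and the row's per-orbit CITED exclusions `hX_…` universally quantified in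
the exponent. Conclusion = the census statement of the SIGNED row of record `census/rows/C1/C1-C43-even.md` in p1's
vocabulary (`Rows/Statements.lean`): every prime `n ≥ 11`, `n ∤ 43`, no primitive solution with `xy` even.
GENERATED by p-lean gen3/make_c1cell.py (pattern of `Rows/BridgeC1P2.lean`).
-/

namespace Summit.Ventures.AbcSig

/-- `xⁿ + yⁿ = 43z²`, `xy` even, every prime `n ≥ 11` with `n ∤ 43`: p1's `Rows.C1CellEven 43 11 ∅` from `xrow_XnYn43Z2Even`. -/
theorem C1CellEven_43_of (M : NewformModel) (hP : M.BS04Package)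
    (hEχ : M.EisChiPackage)
    (hD3698 : M.DataComplete 3698 level3698Orbits)
    (hRc_orbit_3698_8 : M.Refines 3698 orbit_3698_8 m6chiX_3698_8) :
    Rows.C1CellEven 43 11 ∅ :=
  fun n hn h11 hC _ x y z hpar =>
    xrow_XnYn43Z2Even M hP hEχ hD3698 hRc_orbit_3698_8 n hn h11 (by
      intro hmem
      simp only [List.mem_cons, List.not_mem_nil, or_false] at hmem
      subst hmem
      exact hC (by norm_num)) x y z hpar

end Summit.Ventures.AbcSig
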